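import Literature.NumberTheory.Sieve.FordMaynardFragmentationClaim
import HarnessLib

/-!
# Ford–Maynard, Theorem 6.4: splitting the iterated integrals into two groups of blocks

Everything here is PROVED. Eighth file towards Theorem 6.4 of K. Ford, J. Maynard,
*On the theory of prime producing sieves* (arXiv:2407.14368), serving the converse direction
(6.3) ⇒ (TypeI-f) (§6.1): when the fragmentation relation is applied to a vector `(u, ξ)`, the
blocks of `u` and the blocks of `ξ` are to be integrated separately ("with `u` fixed, consider
`A(u₁,…,u_r)`"). The tools:

* `bsum_add`, **`multiSlice_split`**: the iterated product-slice integral over `d + r` blocks is the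
  iterated integral over the first `d` blocks of the iterated integral over the last `r` blocks;
* `sum_piFinset_castAdd_natAdd`: splitting sums over block-size vectors of length `d + r`;
* index bookkeeping for the blocks of a vector `(β, β') ∈ ℝ^{bsum d k + bsum r k'}` at the
  positions prescribed by `Fin.append k k'`
  (`val_finSigmaFinEquiv_castAdd`, `val_finSigmaFinEquiv_natAdd`), whence the product of block
  weights over the `d + r` blocks splits (`prod_blockWeight_split`);
* `prod_blocks_eq_prod`: the product over the blocks of the products of their entries is the
  product of all entries, so that `∏_j w_{k_j}(β_j) = (∏_j 𝓛(β_j)/k_j!)/∏_t β_t`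
  (`prod_blockWeight_eq`);
* **`fragH_split`**: the iterated integrand of (6.3) over `d + r` blocks at `(u, ξ)` is the
  iterated integral over the `u`-blocks of the iterated integral over the `ξ`-blocks.

## References

* K. Ford, J. Maynard, *On the theory of prime producing sieves*, arXiv:2407.14368 (2024), §6.1
  (proof of Theorem 6.4, (6.3) ⇒ (TypeI-f)). [FordMaynard2024PrimeSieves]
-/

noncomputable section

open MeasureTheory Finset Literature.Combinatorics.Enumerative

namespace Literature.NumberTheory.Sieve.FordMaynard

/-! ### `multiSlice` over two groups of blocks -/

/-- `bsum` of an appended block-size vector. [folklore] -/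
theorem bsum_add (d r : ℕ) (kv : Fin (d + r) → ℕ) :
    bsum (d + r) kv = bsum d (fun i => kv (Fin.castAdd r i)) + bsum r (fun j => kv (Fin.natAdd d j)) := by
  rw [bsum_eq_sum, bsum_eq_sum, bsum_eq_sum, Fin.sum_univ_add]

/-- Nested appends with casts, evaluated at positions with the same value. [folklore] -/
theorem append_append_apply_eq {p q r' : ℕ} (a : Fin p → ℝ) (b : Fin q → ℝ) (c : Fin r' → ℝ)
    {n₁ : ℕ} (e₁ : n₁ = p + q) {n₂ : ℕ} (e₂ : n₂ = p + (q + r')) (x : Fin (n₁ + r')) (y : Fin n₂)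
    (hxy : (x : ℕ) = y) :
    Fin.append (Fin.append a b ∘ Fin.cast e₁) c x = (Fin.append a (Fin.append b c) ∘ Fin.cast e₂) y := by
  subst e₁
  subst e₂
  have hx : x = Fin.cast (Nat.add_assoc p q r').symm y := Fin.ext hxy
  subst hx
  exact congr_fun (Fin.append_assoc a b c) (Fin.cast (Nat.add_assoc p q r').symm y)

/-- **`multiSlice` over `d + r` blocks** is `multiSlice` over the first `d` blocks of
`multiSlice` over the last `r` blocks. [folklore] -/
theorem multiSlice_split (d : ℕ) :
    ∀ (r : ℕ) (kv : Fin (d + r) → ℕ) (ψ : Fin (d + r) → ℝ) (H : (Fin (bsum (d + r) kv) → ℝ) → ℝ),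
      multiSlice (d + r) kv ψ H =
        multiSlice d (fun i => kv (Fin.castAdd r i)) (fun i => ψ (Fin.castAdd r i)) (fun β =>
          multiSlice r (fun j => kv (Fin.natAdd d j)) (fun j => ψ (Fin.natAdd d j)) (fun β' =>
            H (Fin.append β β' ∘ Fin.cast (bsum_add d r kv))))
  | 0, kv, ψ, H => by
    simp only [multiSlice_zero]
    show multiSlice d kv ψ H = _
    refine multiSlice_congr d _ _ fun β => congrArg H (funext fun x => ?_)
    exact (append_apply_eq_left_of_val β _ _ x rfl).symm
  | r + 1, kv, ψ, H => by
    show multiSlice (d + r + 1) kv ψ H = _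
    rw [multiSlice_succ, multiSlice_split d r]
    simp only [multiSlice_succ]
    refine multiSlice_congr d (fun i => kv (Fin.castAdd (r + 1) i)) (fun i => ψ (Fin.castAdd (r + 1) i))
      fun β => ?_
    refine multiSlice_congr r (fun j => kv (Fin.natAdd d (Fin.castSucc j)))
      (fun j => ψ (Fin.natAdd d (Fin.castSucc j))) fun β' => ?_
    show sliceIntegral (kv (Fin.natAdd d (Fin.last r))) (ψ (Fin.natAdd d (Fin.last r))) _ =
      sliceIntegral (kv (Fin.natAdd d (Fin.last r))) (ψ (Fin.natAdd d (Fin.last r))) _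
    congr 1
    funext v
    refine congrArg H (funext fun x => ?_)
    exact append_append_apply_eq β β' v _ _ x x rfl

/-- Splitting a sum over block-size vectors of length `d + r` into the first `d` and the last `r`
sizes. [folklore] -/
theorem sum_piFinset_castAdd_natAdd {d r : ℕ} (s : Finset ℕ) (G : (Fin d → ℕ) → (Fin r → ℕ) → ℝ) :
    ∑ kv ∈ Fintype.piFinset (fun _ : Fin (d + r) => s),
        G (fun i => kv (Fin.castAdd r i)) (fun j => kv (Fin.natAdd d j)) =
      ∑ h ∈ Fintype.piFinset (fun _ : Fin d => s), ∑ h' ∈ Fintype.piFinset (fun _ : Fin r => s), G h h' := by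
  rw [← Finset.sum_product']
  refine Finset.sum_nbij' (fun kv => (fun i => kv (Fin.castAdd r i), fun j => kv (Fin.natAdd d j)))
    (fun p => Fin.append p.1 p.2) ?_ ?_ ?_ ?_ ?_
  · intro kv hkv
    simp only [Fintype.mem_piFinset] at hkv
    simp only [Finset.mem_product, Fintype.mem_piFinset]
    exact ⟨fun i => hkv _, fun j => hkv _⟩
  · intro p hp
    simp only [Finset.mem_product, Fintype.mem_piFinset] at hp
    simp only [Fintype.mem_piFinset]
    intro i
    refine Fin.addCases (fun l => ?_) (fun l => ?_) i
    · rw [Fin.append_left]; exact hp.1 l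
    · rw [Fin.append_right]; exact hp.2 l
  · intro kv _
    exact Fin.append_castAdd_natAdd
  · intro p _
    refine Prod.ext ?_ ?_
    · funext i; exact Fin.append_left _ _ i
    · funext j; exact Fin.append_right _ _ j
  · intro kv _
    rfl

/-! ### Blocks of `(β, β')` at the positions of `Fin.append k k'` -/

/-- Position of the `l`-th entry of block `castAdd r i` of `kv`: that of block `i` of the first
sizes. [folklore] -/
theorem val_finSigmaFinEquiv_castAdd {d r : ℕ} (kv : Fin (d + r) → ℕ) (i : Fin d)
    (l : Fin (kv (Fin.castAdd r i))) :
    (finSigmaFinEquiv (n := kv) ⟨Fin.castAdd r i, l⟩ : ℕ) =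
      (finSigmaFinEquiv (n := fun i => kv (Fin.castAdd r i)) ⟨i, l⟩ : ℕ) := by
  rw [finSigmaFinEquiv_apply, finSigmaFinEquiv_apply]
  rfl

/-- Position of the `l`-th entry of block `natAdd d j` of `kv`: `bsum` of the first sizes plus
that of block `j` of the last sizes. [folklore] -/
theorem val_finSigmaFinEquiv_natAdd {d r : ℕ} (kv : Fin (d + r) → ℕ) (j : Fin r)
    (l : Fin (kv (Fin.natAdd d j))) :
    (finSigmaFinEquiv (n := kv) ⟨Fin.natAdd d j, l⟩ : ℕ) =
      (∑ i : Fin d, kv (Fin.castAdd r i)) + (finSigmaFinEquiv (n := fun j => kv (Fin.natAdd d j)) ⟨j, l⟩ : ℕ) := by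
  rw [finSigmaFinEquiv_apply, finSigmaFinEquiv_apply]
  have : ∑ x : Fin (Fin.natAdd d j : ℕ), kv (Fin.castLE (Fin.natAdd d j).2.le x) =
      (∑ i : Fin d, kv (Fin.castAdd r i)) + ∑ x : Fin (j : ℕ), kv (Fin.natAdd d (Fin.castLE j.2.le x)) := by
    show ∑ x : Fin (d + (j : ℕ)), kv (Fin.castLE (Fin.natAdd d j).2.le x) = _
    rw [Fin.sum_univ_add]
    rfl
  rw [this, add_assoc]

/-- In `(β, β')`, the entry at the position of the `l`-th element of block `castAdd r i` is the
corresponding entry of `β`. [folklore] -/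
theorem append_apply_cast_finSigmaFinEquiv_castAdd {d r : ℕ} (kv : Fin (d + r) → ℕ)
    (β : Fin (bsum d (fun i => kv (Fin.castAdd r i))) → ℝ)
    (β' : Fin (bsum r (fun j => kv (Fin.natAdd d j))) → ℝ) (i : Fin d) (l : Fin (kv (Fin.castAdd r i))) :
    (Fin.append β β' ∘ Fin.cast (bsum_add d r kv))
        (Fin.cast (bsum_eq_sum (d + r) kv).symm (finSigmaFinEquiv (n := kv) ⟨Fin.castAdd r i, l⟩)) =
      β (Fin.cast (bsum_eq_sum d (fun i => kv (Fin.castAdd r i))).symm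
        (finSigmaFinEquiv (n := fun i => kv (Fin.castAdd r i)) ⟨i, l⟩)) := by
  simp only [Function.comp_apply]
  refine append_apply_eq_left_of_val β β' _ _ ?_
  simp only [Fin.val_cast, val_finSigmaFinEquiv_castAdd]

/-- In `(β, β')`, the entry at the position of the `l`-th element of block `natAdd d j` is the
corresponding entry of `β'`. [folklore] -/
theorem append_apply_cast_finSigmaFinEquiv_natAdd {d r : ℕ} (kv : Fin (d + r) → ℕ)
    (β : Fin (bsum d (fun i => kv (Fin.castAdd r i))) → ℝ)
    (β' : Fin (bsum r (fun j => kv (Fin.natAdd d j))) → ℝ) (j : Fin r) (l : Fin (kv (Fin.natAdd d j))) :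
    (Fin.append β β' ∘ Fin.cast (bsum_add d r kv))
        (Fin.cast (bsum_eq_sum (d + r) kv).symm (finSigmaFinEquiv (n := kv) ⟨Fin.natAdd d j, l⟩)) =
      β' (Fin.cast (bsum_eq_sum r (fun j => kv (Fin.natAdd d j))).symm
        (finSigmaFinEquiv (n := fun j => kv (Fin.natAdd d j)) ⟨j, l⟩)) := by
  simp only [Function.comp_apply]
  refine append_apply_eq_right_of_val β β' _ _ ?_
  simp only [Fin.val_cast, val_finSigmaFinEquiv_natAdd, bsum_eq_sum]

/-- **The product of block weights over `d + r` blocks splits** at `(β, β')`. [folklore] -/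
theorem prod_blockWeight_split (γ : ℝ) {d r : ℕ} (kv : Fin (d + r) → ℕ)
    (β : Fin (bsum d (fun i => kv (Fin.castAdd r i))) → ℝ)
    (β' : Fin (bsum r (fun j => kv (Fin.natAdd d j))) → ℝ) :
    (∏ j : Fin (d + r), blockWeight γ (kv j) (fun l => (Fin.append β β' ∘ Fin.cast (bsum_add d r kv))
        (Fin.cast (bsum_eq_sum (d + r) kv).symm (finSigmaFinEquiv (n := kv) ⟨j, l⟩)))) =
      (∏ i : Fin d, blockWeight γ (kv (Fin.castAdd r i)) (fun l =>
          β (Fin.cast (bsum_eq_sum d (fun i => kv (Fin.castAdd r i))).symm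
            (finSigmaFinEquiv (n := fun i => kv (Fin.castAdd r i)) ⟨i, l⟩)))) *
        ∏ j : Fin r, blockWeight γ (kv (Fin.natAdd d j)) (fun l =>
          β' (Fin.cast (bsum_eq_sum r (fun j => kv (Fin.natAdd d j))).symm
            (finSigmaFinEquiv (n := fun j => kv (Fin.natAdd d j)) ⟨j, l⟩))) := by
  rw [Fin.prod_univ_add]
  congr 1
  · refine Finset.prod_congr rfl fun i _ => ?_
    congr 1
    funext l
    exact append_apply_cast_finSigmaFinEquiv_castAdd kv β β' i l
  · refine Finset.prod_congr rfl fun j _ => ?_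
    congr 1
    funext l
    exact append_apply_cast_finSigmaFinEquiv_natAdd kv β β' j l

/-! ### The product over all blocks of all entries -/

/-- The product over the blocks of the products of their entries is the product of all entries.
[folklore] -/
theorem prod_blocks_eq_prod {s : ℕ} (h : Fin s → ℕ) (β : Fin (bsum s h) → ℝ) :
    (∏ j, ∏ i : Fin (h j), β (Fin.cast (bsum_eq_sum s h).symm (finSigmaFinEquiv (n := h) ⟨j, i⟩))) =
      ∏ t, β t := by
  rw [← Fintype.prod_sigma' (fun j (i : Fin (h j)) =>
    β (Fin.cast (bsum_eq_sum s h).symm (finSigmaFinEquiv (n := h) ⟨j, i⟩)))]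
  exact Fintype.prod_equiv ((finSigmaFinEquiv (n := h)).trans (finCongr (bsum_eq_sum s h).symm)) _ _
    fun x => rfl

/-- **Block weights versus block Linnik factors**:
`∏_j w_{h_j}(β_j) = (∏_j 𝓛(β_j)/h_j!) / ∏_t β_t`. [folklore] -/
theorem prod_blockWeight_eq (γ : ℝ) {s : ℕ} (h : Fin s → ℕ) (β : Fin (bsum s h) → ℝ) :
    (∏ j, blockWeight γ (h j) (fun i => β (Fin.cast (bsum_eq_sum s h).symm (finSigmaFinEquiv (n := h) ⟨j, i⟩)))) =
      (∏ j, linnikFn (1 - γ) (fun i =>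
          β (Fin.cast (bsum_eq_sum s h).symm (finSigmaFinEquiv (n := h) ⟨j, i⟩))) univ /
            ((h j).factorial : ℝ)) / ∏ t, β t := by
  rw [← prod_blocks_eq_prod h β, ← Finset.prod_div_distrib]
  refine Finset.prod_congr rfl fun j _ => ?_
  unfold blockWeight
  rw [div_div]

/-! ### The iterated integrand of (6.3) at `(u, ξ)` -/

/-- **The iterated integrand over `d + r` blocks at `(u, ξ)` splits**: the blocks of `u` outside,
the blocks of `ξ` inside; the admissibility condition and the product of the weights factor, and
`g(∑ k)((β, β') ∘ casts) = g(|k_u| + |k_ξ|)(β, β')`.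
[cite: FordMaynard2024PrimeSieves, §6.1 (proof of Theorem 6.4, (6.3) ⇒ (TypeI-f))] -/
theorem fragH_split (γ η : ℝ) (g : VecFn) {d r : ℕ} (kv : Fin (d + r) → ℕ) (u : Fin d → ℝ)
    (ξ : Fin r → ℝ) :
    multiSlice (d + r) kv (Fin.append u ξ) (fun β => if ∀ t, η ≤ β t then
        (∏ j, blockWeight γ (kv j) (fun i =>
            β (Fin.cast (bsum_eq_sum (d + r) kv).symm (finSigmaFinEquiv (n := kv) ⟨j, i⟩)))) *
          g (∑ j, kv j) (β ∘ Fin.cast (bsum_eq_sum (d + r) kv).symm) else 0) =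
      multiSlice d (fun i => kv (Fin.castAdd r i)) u (fun β =>
        multiSlice r (fun j => kv (Fin.natAdd d j)) ξ (fun β' =>
          if (∀ t, η ≤ β t) ∧ (∀ t, η ≤ β' t) then
            (∏ i : Fin d, blockWeight γ (kv (Fin.castAdd r i)) (fun l =>
                β (Fin.cast (bsum_eq_sum d (fun i => kv (Fin.castAdd r i))).symm
                  (finSigmaFinEquiv (n := fun i => kv (Fin.castAdd r i)) ⟨i, l⟩)))) *
              (∏ j : Fin r, blockWeight γ (kv (Fin.natAdd d j)) (fun l =>
                β' (Fin.cast (bsum_eq_sum r (fun j => kv (Fin.natAdd d j))).symm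
                  (finSigmaFinEquiv (n := fun j => kv (Fin.natAdd d j)) ⟨j, l⟩)))) *
              g (bsum d (fun i => kv (Fin.castAdd r i)) + bsum r (fun j => kv (Fin.natAdd d j)))
                (Fin.append β β')
          else 0)) := by
  rw [multiSlice_split]
  simp only [Fin.append_left, Fin.append_right]
  refine multiSlice_congr d _ _ fun β => multiSlice_congr r _ _ fun β' => ?_
  have hiff : (∀ t, η ≤ (Fin.append β β' ∘ Fin.cast (bsum_add d r kv)) t) ↔
      (∀ t, η ≤ β t) ∧ ∀ t, η ≤ β' t := by
    constructor
    · intro hc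
      refine ⟨fun t => ?_, fun t => ?_⟩
      · have h1 := hc (Fin.cast (bsum_add d r kv).symm (Fin.castAdd _ t))
        have h2 : (Fin.append β β' ∘ Fin.cast (bsum_add d r kv))
            (Fin.cast (bsum_add d r kv).symm (Fin.castAdd _ t)) = β t := Fin.append_left β β' t
        rwa [h2] at h1
      · have h1 := hc (Fin.cast (bsum_add d r kv).symm (Fin.natAdd _ t))
        have h2 : (Fin.append β β' ∘ Fin.cast (bsum_add d r kv))
            (Fin.cast (bsum_add d r kv).symm (Fin.natAdd _ t)) = β' t := Fin.append_right β β' t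
        rwa [h2] at h1
    · rintro ⟨h1, h2⟩ t
      simp only [Function.comp_apply]
      refine Fin.addCases (fun l => ?_) (fun l => ?_) (Fin.cast (bsum_add d r kv) t)
      · rw [Fin.append_left]; exact h1 l
      · rw [Fin.append_right]; exact h2 l
  by_cases hc : (∀ t, η ≤ β t) ∧ ∀ t, η ≤ β' t
  · rw [if_pos (hiff.2 hc), if_pos hc, prod_blockWeight_split]
    congr 1
    exact VecFn.apply_congr g ((bsum_eq_sum (d + r) kv).symm.trans (bsum_add d r kv)) _ _ fun i => rfl
  · rw [if_neg (fun h' => hc (hiff.1 h')), if_neg hc]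

end Literature.NumberTheory.Sieve.FordMaynard
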